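/-
Copyright (c) 2026 the pub-hodgecm-mathlib formalisation cell (harness21).  Prover seat hodgecm-mathlib-LH4-p16 (g3), req620 Track A «(D-RAM) FOUR-FRAME» squad
((β₂) road (R-36), the K6 road — K6 DESK WORD #14 «ARCHITECTURE A»: ONE inside chart per live row, its `(1, α)`-coordinates and its label dictionary at `g = 1`, packaged once for
every inside cell and both frames; consumer ★ F1b p864627 `rowTower_cellDiff_mul_card_eq` (LH4-p18 (g4)) and the CORE assembly), 2026-09-05.
-/
import Summits.HodgeConjecture.HodgeConjecture.Theorems.F0P3cDyRamRamKFrameClassLetters        -- ★ p864373 (LH4-p19 (g3)): `exists_refPair_of_frame` (a trace-one ∕ anti reference pair of any even size)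
import Summits.HodgeConjecture.HodgeConjecture.Theorems.F0P3cDyRamConeCellCleanRegimeBoundary  -- ★ (LH4-p19 lineage): `exists_eq_map_add_map_mul_of_v_le_one` (the `(1, α)`-coordinates of an integral element)
import Summits.HodgeConjecture.HodgeConjecture.Theorems.F0P3cDyRamAffineLabelAnyParity          -- ★ p862927 (LH4-p16 (g2)): `exists_affineLabel_of_coords_any` (the affine label dictionary, any parity)
import HarnessLib

/-!
# Crux `H413`, line LH4 «(D-RAM) FOUR-FRAME» — (β₂) road, K6 ARCHITECTURE A: «THE ROW'S INSIDE CHART AND ITS LABEL LETTERS» — once per live row `|lam − jE u₀₀| = exp(−m)`,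
# `|μ − ρμ| = exp(−jl)`, `jl = m + 2N`, `N ≥ 1`: a reference pair `(κ₀, ξ₀)` with `|ξ₀| = exp 2(N − 1)` (the INSIDE chart: every inside cell `(b + 2i, b)`, `i ≤ N − 1`, is an
# integral digit sphere of it), the `(1, α)`-coordinates `(μa, μb)` of `μ`, the pulled-back letters `R₀ = Tr_ρ(ακ₀)`, `γ₀ = ξ₀(α − ρα)`, their SIZES `|μa + μb·R₀| = |ϖ|^m`,
# `|μb·γ₀| = |ϖ|^{m+2}`, and the affine label dictionary `(α₁, γ₁)` of ★ p862927 at `g = 1` (`|γ₁| = |ϖ|²`) — exactly the chart binders of ★ F1b p864627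

Cell `hodgecm-mathlib` (D-0151), FLOOR 0, crux item H413 = `stmt-HodgeConjecture-24833`, route of record `HCCMUnconditional`; squad F0∕P3c∕LH4 (hand LH4-p16 (g3), the K6 desk);
lane `--supports stmt-HodgeConjecture-24833 --as helper` (count-neutral; pays NO tier-0 row).  THEOREMS ONLY (no `def`, no instance, no notation, no `sorry`, default heartbeats);
★-only imports; states NO law.

WHAT (K6 DESK WORDS #10∕#14).  The per-cell socket instance ★ F1b `…RowTowerCellPerCellValue.rowTower_cellDiff_mul_card_eq` takes its CHART as INPUT letters: `{κ₀ ξ₀} (hκ₀ : κ₀ + ρκ₀ = 1)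
(hΘκ₀) (hκ₀1 : |κ₀| ≤ 1) (hξ : ρξ₀ = −ξ₀) (hΘξ) {g} (hg1 : 1 ≤ g) (hcell : j + b + 2g ≤ jl) (hξv : |ξ₀|·|jEϖ|^jl = |jEϖ|^(2b + 2g)) {μa μb R₀ γ₀} (hμab : lam − jE u₀₀ = jE μa + jE μb·α)
(hR₀ : jE R₀ = ακ₀ + ρ(ακ₀)) (hγ₀ : jE γ₀ = ξ₀(α − ρα)) {α₁ γ₁} (hα₁σ) (hα₁1 : |α₁| = 1) (hγ₁σ) (hγ₁1 : |γ₁| < 1) (haff : ★ p862927's ∀-clause at â := (μa + μbR₀)·P⁻¹,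
b̂ := μbγ₀·P⁻¹, P = (ϖσϖ)^b)`.  HEAD `exists_rowInsideChart_letters` produces ALL of them at once, at `g = 1`, for the live row of a CORE∕FLIPT letter (`2b + d%2 = m`, `jl = m + 2N`,
`1 ≤ N`), from the line-model letters the CORE letters carry (`hρρ hvρ hΘρ hα hα1 hint hU hτ hσres hDM hq hjiso hjfix hΘj`): the pair from ★ `exists_refPair_of_frame` at `n := N − 1`,
the coordinates from ★ `exists_eq_map_add_map_mul_of_v_le_one`, `R₀ γ₀` from `Fix ρ = jE(E)`, the two SIZES by the ultrametric split `μκ₀ + ρ(μκ₀) = ρμ + (μ − ρμ)·κ₀`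
(`|μ − ρμ| = exp(−jl) < exp(−m) = |ρμ|`) and `μ − ρμ = jE μb·(α − ρα)`, and the dictionary from ★ p862927 `exists_affineLabel_of_coords_any` at `|â| = |ϖ|^{d%2}`, `|b̂| = |ϖ|^{2+d%2}`,
`g = 1`.  So `(α₁, γ₁)` are ONE pair per ROW and CHART — independent of the frame `(H₂, h_W, φ, h)` (LH4-p18 (g4) 02:10:55Z confirmed the dictionary is frame-free) — and both literals
of ‹CORE-3›∕‹CORE-ODD› read the SAME label character `ω V = normSign σ (α₁ + γ₁·V)` on the SAME digit line, as the spine ★ p864340 ∕ ★ (g) p864489 require.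
WHAT IS NOT CLAIMED: any cell value, any count, the precision letters (cell-dependent, K6 DESK WORD #14 (2)), the class letters (★ p864373 `fgap_of_datum` &c.), the top cell's chart.
HONEST LABEL.  Count-neutral valuation bookkeeping over ★ heads; nothing printed is asserted; ‹CORE-3›∕‹CORE-ODD›∕‹FLIPT›, β₂ stay HYPOTHESES; `HC_CM` is proved only modulo the 7
printed citations (2 remaining named inputs: hLiu418 = `stmt-HodgeConjecture-24832`, h413 = `stmt-HodgeConjecture-24833`) until rung 0 closes.
## References
* [Kottwitz1986BaseChangeUnits] R. E. Kottwitz, *Base change for unit elements of Hecke algebras*, Compositio Math. 60 (1986): §1 pp. 240–241 (cell-by-cell fixed-lattice counts).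
* [Rogawski1990] J. D. Rogawski, *Automorphic Representations of Unitary Groups in Three Variables*, Ann. of Math. Stud. 123 (1990): §4.9 Prop. 4.9.1 (b) p. 55 (the labelled census).
* [Serre1979] J.-P. Serre, *Local Fields*, GTM 67 (1979): Ch. V §3 Cor. 3 pp. 84–86 (norm-residue sign and its conductor); Ch. IV §2 Prop. 6 (digit systems).
-/

set_option autoImplicit false

noncomputable section

namespace Summit.HodgeConjecture.HodgeConjecture.Cruxes.H413.F0P3cDyRamRowInsideChartLetters

open scoped Valued WithZero
open WithZero
open Literature.NumberTheory.Automorphic.UnitaryThreeFourFrame (IsRamifiedQuadraticDatum normSign)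
open Summit.HodgeConjecture.HodgeConjecture.Cruxes.H413.F0P3cDyRamFourFramePieces (mstarOfRecord)
open Summit.HodgeConjecture.HodgeConjecture.Cruxes.H413.F0P3cDyRamRamKFrameClassLetters (exists_refPair_of_frame)
open Summit.HodgeConjecture.HodgeConjecture.Cruxes.H413.F0P3cDyRamConeCellCleanRegimeBoundary (exists_eq_map_add_map_mul_of_v_le_one)
open Summit.HodgeConjecture.HodgeConjecture.Cruxes.H413.F0P3cDyRamAffineLabelAnyParity (exists_affineLabel_of_coords_any)

variable {E M : Type} [Field E] [Valued E ℤᵐ⁰] [Field M] [Valued M ℤᵐ⁰] {ρ Θ : M →+* M} {α : M}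

/-! ## §1 Two size letters of the live row in a reference pair of size `exp 2(N − 1)` -/

/-- **THE CONSTANT TERM**: for a trace-one `κ₀` (`κ₀ + ρκ₀ = 1`, `|κ₀| ≤ 1`) and `μ` with `|μ| = exp(−m)`, `|μ − ρμ| = exp(−jl)`, `m < jl`:
`|μκ₀ + ρ(μκ₀)| = exp(−m)` — since `μκ₀ + ρ(μκ₀) = ρμ + (μ − ρμ)κ₀` and the second term is strictly smaller. [cite: Kottwitz1986BaseChangeUnits, §1 pp. 240–241] -/
theorem v_mul_add_map_mul_eq (hvρ : ∀ x, Valued.v (ρ x) = Valued.v x)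
    {κ₀ : M} (hκ₀ : κ₀ + ρ κ₀ = 1) (hκ₀1 : Valued.v κ₀ ≤ 1)
    {μ : M} {m jl : ℕ} (hm : Valued.v μ = exp (-(m : ℤ))) (hjl : Valued.v (μ - ρ μ) = exp (-(jl : ℤ))) (hmjl : m < jl) :
    Valued.v (μ * κ₀ + ρ (μ * κ₀)) = exp (-(m : ℤ)) := by
  have e : μ * κ₀ + ρ (μ * κ₀) = ρ μ + (μ - ρ μ) * κ₀ := by
    have hρκ : ρ κ₀ = 1 - κ₀ := by rw [← hκ₀]; ring
    rw [map_mul, hρκ]; ring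
  have hlt : Valued.v ((μ - ρ μ) * κ₀) < Valued.v (ρ μ) := by
    rw [Valuation.map_mul, hjl, hvρ, hm]
    calc exp (-(jl : ℤ)) * Valued.v κ₀ ≤ exp (-(jl : ℤ)) * 1 := by gcongr
      _ = exp (-(jl : ℤ)) := mul_one _
      _ < exp (-(m : ℤ)) := exp_lt_exp.2 (by omega)
  rw [e, Valuation.map_add_eq_of_lt_left _ hlt, hvρ, hm]

omit [Valued E ℤᵐ⁰] in
/-- **THE SLOPE COEFFICIENT**: if `μ = jE μa + jE μb·α` with `jE(E) ⊆ Fix ρ`, then `μ − ρμ = jE μb·(α − ρα)`, so with `|α − ρα| = 1`: `|jE μb| = |μ − ρμ|`.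
[cite: Kottwitz1986BaseChangeUnits, §1 pp. 240–241] -/
theorem v_map_snd_eq (jE : E →+* M) (hρj : ∀ c, ρ (jE c) = jE c) (hU : Valued.v (α - ρ α) = 1)
    {μ : M} {μa μb : E} (hμab : μ = jE μa + jE μb * α) :
    Valued.v (jE μb) = Valued.v (μ - ρ μ) := by
  have e : μ - ρ μ = jE μb * (α - ρ α) := by rw [hμab, map_add, map_mul, hρj, hρj]; ring
  rw [e, Valuation.map_mul, hU, mul_one]

/-! ## §2 HEAD — the inside chart and its letters, once per row -/

/-- **HEAD — «THE ROW'S INSIDE CHART AND ITS LABEL LETTERS».**  Line-model letters of the CORE frame; the live row `|lam − jE u₀₀| = exp(−m)`, `|μ − ρμ| = exp(−jl)` with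
`2b + d%2 = m` (both parities), `jl = m + 2N`, `1 ≤ N`.  THEN there are `κ₀ ξ₀ : M` and `μa μb R₀ γ₀ α₁ γ₁ : E` with: `κ₀ + ρκ₀ = 1`, `Θκ₀ = κ₀`, `|κ₀| ≤ 1`, `|κ₀| = 1` (a trace-one element has size `≥ 1`), `ρξ₀ = −ξ₀`, `Θξ₀ = ξ₀`,
`ξ₀ ≠ 0`, `|ξ₀| = exp 2(N−1)`, `|ξ₀|·|jEϖ|^jl = |jEϖ|^(m+2)` (= F1b's `hξv` at `g = 1` after `2b = m`, resp. F1b-ODD's after `2b + 1 = m`); `lam − jE u₀₀ = jE μa + jE μb·α`,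
`jE R₀ = ακ₀ + ρ(ακ₀)`, `jE γ₀ = ξ₀(α − ρα)`; the SIZES `|μa + μb·R₀| = |ϖ|^m`, `|μb·γ₀| = |ϖ|^(m+2)`; and the dictionary `σα₁ = α₁`, `|α₁| = 1`, `σγ₁ = γ₁`, `|γ₁| = |ϖ|^2`,
`|γ₁| < 1`, `haff` = ★ p862927's ∀-clause at `â := (μa + μb·R₀)·((ϖσϖ)^b)⁻¹`, `b̂ := μb·γ₀·((ϖσϖ)^b)⁻¹` — F1b ★ p864627's chart binders BYTE FOR BYTE.
[cite: Kottwitz1986BaseChangeUnits, §1 pp. 240–241] [cite: Rogawski1990, §4.9 Prop. 4.9.1 (b) p. 55] [cite: Serre1979, Ch. V §3 Cor. 3 pp. 84–86] -/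
theorem exists_rowInsideChart_letters [CompleteSpace E] [Finite 𝓀[E]] [CompleteSpace M] [Finite 𝓀[M]]
    {σ : E →+* E} {ϖ : E} {d tE : ℕ} (hD : IsRamifiedQuadraticDatum σ ϖ d tE)
    (jE : E →+* M) (hjiso : ∀ a, Valued.v (jE a) = Valued.v a) (hjfix : ∀ z, ρ z = z ↔ ∃ c, jE c = z) (hΘj : ∀ c, Θ (jE c) = jE (σ c))
    (hρρ : ∀ x, ρ (ρ x) = x) (hvρ : ∀ x, Valued.v (ρ x) = Valued.v x) (hΘρ : ∀ x, Θ (ρ x) = ρ (Θ x))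
    (hα : ρ α ≠ α) (hα1 : Valued.v α ≤ 1) (hint : ∀ z : M, Valued.v z ≤ 1 → Valued.v ((z - ρ z) / (α - ρ α)) ≤ 1)
    (hU : Valued.v (α - ρ α) = 1) (hDM : IsRamifiedQuadraticDatum Θ (jE ϖ) d tE)
    {q : ℕ} (hq : Nat.card 𝓀[M] = q ^ 2)
    (hσres : ∀ z : M, ρ z = z → Valued.v z ≤ 1 → Valued.v (Θ z - z) < 1) (hτ : Valued.v (α - Θ α) < 1)
    (lam : M) (u00 : E) {m jl : ℕ} (hm : Valued.v (lam - jE u00) = exp (-(m : ℤ)))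
    (hjl : Valued.v ((lam - jE u00) - ρ (lam - jE u00)) = exp (-(jl : ℤ)))
    {b : ℕ} (hbm : 2 * b + d % 2 = m) {N : ℕ} (hN1 : 1 ≤ N) (hNjl : m + 2 * N = jl) :
    ∃ (κ₀ ξ₀ : M) (μa μb R₀ γ₀ α₁ γ₁ : E),
      κ₀ + ρ κ₀ = 1 ∧ Θ κ₀ = κ₀ ∧ Valued.v κ₀ ≤ 1 ∧ Valued.v κ₀ = 1 ∧ ρ ξ₀ = -ξ₀ ∧ Θ ξ₀ = ξ₀ ∧ ξ₀ ≠ 0 ∧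
      Valued.v ξ₀ = exp (2 * ((N : ℤ) - 1)) ∧ Valued.v ξ₀ * Valued.v (jE ϖ) ^ jl = Valued.v (jE ϖ) ^ (m + 2) ∧
      lam - jE u00 = jE μa + jE μb * α ∧ jE R₀ = α * κ₀ + ρ (α * κ₀) ∧ jE γ₀ = ξ₀ * (α - ρ α) ∧
      Valued.v (μa + μb * R₀) = Valued.v ϖ ^ m ∧ Valued.v (μb * γ₀) = Valued.v ϖ ^ (m + 2) ∧
      σ α₁ = α₁ ∧ Valued.v α₁ = 1 ∧ σ γ₁ = γ₁ ∧ Valued.v γ₁ = Valued.v ϖ ^ 2 ∧ Valued.v γ₁ < 1 ∧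
      ∀ (T W f : E), σ T = T → Valued.v T = 1 → σ W = W → Valued.v W ≤ 1 → σ f = f →
        Valued.v (T * ((μa + μb * R₀) * ((ϖ * σ ϖ) ^ b)⁻¹ + μb * γ₀ * ((ϖ * σ ϖ) ^ b)⁻¹ * W) - f * ((ϖ - σ ϖ) * ((ϖ * σ ϖ) ^ ((d - d % 2) / 2))⁻¹)) ≤
          Valued.v ϖ ^ mstarOfRecord d → normSign σ f = normSign σ T * normSign σ (α₁ + γ₁ * W) := by
  obtain ⟨hσσ, hvσ, hϖ, -, -, -, -⟩ := id hD
  have hρj : ∀ c : E, ρ (jE c) = jE c := fun c => (hjfix _).2 ⟨c, rfl⟩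
  have hϖ0 : ϖ ≠ 0 := fun h0 => by rw [h0, map_zero] at hϖ; exact (exp_ne_zero hϖ.symm).elim
  have hϖn : ∀ n : ℕ, Valued.v ϖ ^ n = exp (-(n : ℤ)) := fun n => by rw [hϖ, ← exp_nsmul, nsmul_eq_mul, mul_neg, mul_one]
  have hπn : ∀ n : ℕ, Valued.v (jE ϖ) ^ n = exp (-(n : ℤ)) := fun n => by rw [hjiso, hϖn]
  -- the reference pair of size `exp 2(N − 1)`
  obtain ⟨κ₀, ξ₀, hκ₀, hΘκ₀, hξ, hΘξ, hξ0, hκ₀1, hξv⟩ :=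
    exists_refPair_of_frame hD jE hjiso hjfix hΘj hρρ hvρ hΘρ hα1 hU hDM hq hσres hτ (N - 1)
  have hξv' : Valued.v ξ₀ = exp (2 * ((N : ℤ) - 1)) := by rw [hξv, Nat.cast_sub hN1, Nat.cast_one]
  -- a trace-one element has size at least `1` (★ `…SphereCellGenerator.one_le_v_of_trace_one`, three lines, inlined), hence `|κ₀| = 1`
  have hκ₀v : Valued.v κ₀ = 1 := by
    have h := Valuation.map_add Valued.v κ₀ (ρ κ₀)
    rw [hκ₀, Valuation.map_one, hvρ, max_self] at h
    exact le_antisymm hκ₀1 h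
  -- the `(1, α)`-coordinates of `μ`
  set μ : M := lam - jE u00 with hμ
  have hμ1 : Valued.v μ ≤ 1 := by rw [hm, ← exp_zero]; exact exp_le_exp.2 (by omega)
  obtain ⟨μa, μb, -, -, hμab⟩ := exists_eq_map_add_map_mul_of_v_le_one hρρ hα hα1 hint jE hjfix hμ1
  -- `R₀`, `γ₀` by pull-back along `Fix ρ = jE(E)`
  obtain ⟨R₀, hR₀⟩ := (hjfix (α * κ₀ + ρ (α * κ₀))).1 (by rw [map_add, hρρ, add_comm])
  obtain ⟨γ₀, hγ₀⟩ := (hjfix (ξ₀ * (α - ρ α))).1 (by rw [map_mul, hξ, map_sub, hρρ]; ring)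
  -- SIZE 1: `|μa + μb R₀| = |Tr_ρ(μκ₀)| = exp(−m)`
  have hâE : jE (μa + μb * R₀) = μ * κ₀ + ρ (μ * κ₀) := by
    have hρκ : ρ κ₀ = 1 - κ₀ := by rw [← hκ₀]; ring
    rw [map_add, map_mul, hR₀, hμab]
    simp only [map_add, map_mul, hρj, hρκ]
    ring
  have hâv : Valued.v (μa + μb * R₀) = Valued.v ϖ ^ m := by
    rw [← hjiso, hâE, v_mul_add_map_mul_eq hvρ hκ₀ hκ₀1 hm hjl (by omega), hϖn]
  -- SIZE 2: `|μb γ₀| = |μ − ρμ|·|ξ₀| = exp(−m − 2)`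
  have hbv : Valued.v (μb * γ₀) = Valued.v ϖ ^ (m + 2) := by
    rw [← hjiso, map_mul, Valuation.map_mul, v_map_snd_eq jE hρj hU hμab, hjl, hγ₀, Valuation.map_mul, hU, mul_one, hξv', ← exp_add, hϖn]
    congr 1; push_cast; omega
  -- the chart identity `|ξ₀|·|jEϖ|^jl = |jEϖ|^(m+2)`
  have hξjl : Valued.v ξ₀ * Valued.v (jE ϖ) ^ jl = Valued.v (jE ϖ) ^ (m + 2) := by
    rw [hξv', hπn, hπn, ← exp_add]; congr 1; push_cast; omega
  -- the dictionary at `g = 1`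
  have hPv : Valued.v ((ϖ * σ ϖ) ^ b) = Valued.v ϖ ^ (2 * b) := by rw [Valuation.map_pow, Valuation.map_mul, hvσ, ← pow_two, ← pow_mul, mul_comm]
  have hP0 : (ϖ * σ ϖ) ^ b ≠ 0 := pow_ne_zero _ (mul_ne_zero hϖ0 (by rw [ne_eq, map_eq_zero_iff σ σ.injective]; exact hϖ0))
  have hPv0 : Valued.v ((ϖ * σ ϖ) ^ b) ≠ 0 := (Valuation.ne_zero_iff _).2 hP0
  have hâ : Valued.v ((μa + μb * R₀) * ((ϖ * σ ϖ) ^ b)⁻¹) = Valued.v ϖ ^ (d % 2) := by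
    rw [Valuation.map_mul, map_inv₀, hâv, hPv, ← hbm, pow_add, mul_comm (Valued.v ϖ ^ (2 * b)), mul_assoc, mul_inv_cancel₀ (by rwa [hPv] at hPv0), mul_one]
  have hbh : Valued.v (μb * γ₀ * ((ϖ * σ ϖ) ^ b)⁻¹) = Valued.v ϖ ^ (2 * 1 + d % 2) := by
    rw [Valuation.map_mul, map_inv₀, hbv, hPv, show m + 2 = 2 * b + (2 * 1 + d % 2) by omega, pow_add, mul_comm (Valued.v ϖ ^ (2 * b)), mul_assoc,
      mul_inv_cancel₀ (by rwa [hPv] at hPv0), mul_one]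
  obtain ⟨α₁, γ₁, hα₁σ, hα₁1, hγ₁σ, hγ₁v, haff⟩ := exists_affineLabel_of_coords_any hD hâ hbh le_rfl
  have hγ₁v' : Valued.v γ₁ = Valued.v ϖ ^ 2 := by rw [hγ₁v]
  have hγ₁1 : Valued.v γ₁ < 1 := by rw [hγ₁v', hϖn, ← exp_zero]; exact exp_lt_exp.2 (by norm_num)
  exact ⟨κ₀, ξ₀, μa, μb, R₀, γ₀, α₁, γ₁, hκ₀, hΘκ₀, hκ₀1, hκ₀v, hξ, hΘξ, hξ0, hξv', hξjl, hμab, hR₀, hγ₀, hâv, hbv, hα₁σ, hα₁1, hγ₁σ, hγ₁v', hγ₁1, haff⟩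

end Summit.HodgeConjecture.HodgeConjecture.Cruxes.H413.F0P3cDyRamRowInsideChartLetters

end
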